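import Summits.Ventures.HodgeKum4.Theorems.KummerFixedLocusLefschetzGenerationKum4
import HarnessLib

/-!
# Route KummerFixedLocus (`hodge-kum4`, rung H3) — the L1 glue item `LefschetzGenerationKum4Glue`

Seat p1.  Item stmt-Ventures-19270 (`KummerOrbifoldModelKum4 → KummerTranslationFrameExists →
FrameComplementKum4 → LefschetzGenerationKum4`, route decl
`Summit.Ventures.HodgeKum4.Theses.KummerFixedLocus.LefschetzGenerationKum4Glue`, whose conjuncts are the
aliases of the Statement-level propositions used below) is closed by the kernel transport theorem
`lefschetzGenerationKum4_of_model` (Theorems/KummerFixedLocusLefschetzGenerationKum4, p419894),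
CONDITIONALLY on the one refereed Literature fact it consumes, the Looijenga–Lunts–Verbitsky structure
theorem `LooijengaLuntsVerbitsky_llvStructure_kumType` (LL97 (4.5), GKLR Thm. 14; landed p405144).
-/

namespace Summit.Ventures.HodgeKum4

open Literature.AlgebraicGeometry.Hyperkaehler (LooijengaLuntsVerbitsky_llvStructure_kumType)

/-- **Glue of the L1 split (kernel, conditional on the REFEREED LLV structure fact):**
`KummerOrbifoldModelKum4 → KummerTranslationFrameExists → FrameComplementKum4 → LefschetzGenerationKum4`. -/
theorem lefschetzGenerationKum4Glue_of_llvStructure (hF : LooijengaLuntsVerbitsky_llvStructure_kumType) :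
    Summit.Ventures.HodgeKum4.KummerOrbifoldModelKum4 → Summit.Ventures.HodgeKum4.KummerTranslationFrameExists →
      Summit.Ventures.HodgeKum4.FrameComplementKum4 → Summit.Ventures.HodgeKum4.LefschetzGenerationKum4 :=
  fun hM hex hC ↦ lefschetzGenerationKum4_of_model hM hC hF hex

/-- **Glue of the L1 split, restated form (item stmt-Ventures-19304, route decl
`Summit.Ventures.HodgeKum4.Theses.KummerFixedLocus.LefschetzGenerationKum4Glue`, rev 4): with the
REFEREED LLV structure fact as the leading binder the glue is UNCONDITIONAL (kernel):**
`LooijengaLuntsVerbitsky_llvStructure_kumType → KummerOrbifoldModelKum4 → KummerTranslationFrameExists →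
FrameComplementKum4 → LefschetzGenerationKum4`, by the transport theorem `lefschetzGenerationKum4_of_model`. -/
theorem lefschetzGenerationKum4Glue_holds :
    Literature.AlgebraicGeometry.Hyperkaehler.LooijengaLuntsVerbitsky_llvStructure_kumType →
      Summit.Ventures.HodgeKum4.KummerOrbifoldModelKum4 → Summit.Ventures.HodgeKum4.KummerTranslationFrameExists →
        Summit.Ventures.HodgeKum4.FrameComplementKum4 → Summit.Ventures.HodgeKum4.LefschetzGenerationKum4 :=
  fun hF hM hex hC ↦ lefschetzGenerationKum4_of_model hM hC hF hex

end Summit.Ventures.HodgeKum4
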